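import Summits.ABC.StewartYu.ArchG3LinesAtoms
import Mathlib.Order.Interval.Finset.Fin
import Mathlib.Algebra.Order.Ring.GeomSum
import HarnessLib

/-!
# Cell abc-stewartyu, rung A1.L (crux r2 `ArchCoreRat`, stmt-ABC-20502), WP-L.A: the PATH BOUND `|Cⱼₖ| ≤ 2^{n−1}·N` on the
# weight-sorted saturated basis (plan R49: the n-uniform replacement of the adjugate letter `(n−1)!·N`)

`Summits/ABC/StewartYu/ArchG3LinesPathBound.lean` — cell `abc-stewartyu` (HOME `run/shared/lean/pub/abc-stewartyu/`; seat p5 g9).  Theorems only.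
From the v5 shape letters alone (`U` lower-triangular, `0 ≤ U ≤ N`, index identity `|det C| = N`; hence `C` lower-triangular with
`Uₖₖ·Cₖₖ = N`, `0 < Cₖₖ` — `ArchG3LinesAtoms`): `∏ₖ Cₖₖ = N` (`SatData.prod_C_diag`), so every prefix product `Tₖ = ∏_{l ≤ k} C_ll` is
`≤ N`; and row `k` of `U·C = N·1` at a column `j < k` reads `Uₖₖ·Cₖⱼ = −Σ_{i<k} Uₖᵢ·Cᵢⱼ`, whence `|Cₖⱼ| ≤ Cₖₖ·Σ_{i<k}|Cᵢⱼ|` (using only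
`Uₖᵢ ≤ N = Uₖₖ·Cₖₖ`) and by induction `|Cₖⱼ| ≤ 2ᵏ·Tₖ` (`SatData.abs_C_le_two_pow_mul_prefix`) — **`SatData.abs_C_le_two_pow :
|Cⱼₖ| ≤ 2^{n−1}·N`**.  NO pivot reduction of `U` is needed (STATUS 2026-08-27 21:50Z).

WHAT THIS IS NOT: no change to the START or to the registered texts; no crux moves.

## References
* J. W. S. Cassels, *An Introduction to the Geometry of Numbers*, Ch. I §2.2 (triangular bases and their inverses). [Cassels1997]
-/

noncomputable section

open Finset Matrix
open scoped Nat Matrix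

namespace Summit.ABC.StewartYu

namespace ArchG3Setup

namespace SatData

variable {S : ArchG3Setup} (F : S.SatData)

/-- **`∏ₖ Cₖₖ = N`** (`C` lower-triangular with positive diagonal, `|det C| = N`). [folklore] -/
theorem prod_C_diag (htri : ∀ k j : Fin S.n, k < j → F.U k j = 0) (hbox : ∀ k j : Fin S.n, 0 ≤ F.U k j ∧ F.U k j ≤ (F.N : ℤ))
    (hdet : F.C.det.natAbs = F.N) : ∏ k, F.C k k = F.N := by
  classical
  obtain ⟨hCtri, -, hCpos⟩ := F.shape htri hbox
  have hlow : F.C.BlockTriangular OrderDual.toDual := fun i j hij => hCtri i j (by simpa using hij)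
  have h := det_of_lowerTriangular F.C hlow
  have hpos : 0 < ∏ k, F.C k k := Finset.prod_pos fun k _ => hCpos k
  have h2 : (F.C.det.natAbs : ℤ) = F.C.det := Int.natAbs_of_nonneg (by rw [h]; exact hpos.le)
  rw [← h, ← h2, hdet]

/-- `Σ_{i < k} 2^i ≤ 2^k − 1` over `Fin n` (in `ℤ`). [folklore] -/
theorem sum_two_pow_Iio_le {m : ℕ} (k : Fin m) : ∑ i ∈ Iio k, (2 : ℤ) ^ (i : ℕ) ≤ 2 ^ (k : ℕ) - 1 := by
  have h1 : ∑ i ∈ Iio k, (2 : ℤ) ^ (i : ℕ) = ∑ i ∈ (Iio k).map Fin.valEmbedding, (2 : ℤ) ^ i := by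
    rw [Finset.sum_map]; rfl
  rw [h1, Fin.map_valEmbedding_Iio, Nat.Iio_eq_range]
  have h2 : ∑ i ∈ range (k : ℕ), (2 : ℕ) ^ i = 2 ^ (k : ℕ) - 1 := by
    have := Nat.geomSum_eq (le_refl 2) (k : ℕ)
    simpa using this
  have h3 : ((∑ i ∈ range (k : ℕ), (2 : ℕ) ^ i : ℕ) : ℤ) = ((2 ^ (k : ℕ) - 1 : ℕ) : ℤ) := by rw [h2]
  have h4 : 1 ≤ 2 ^ (k : ℕ) := Nat.one_le_two_pow
  push_cast [Nat.cast_sub h4] at h3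
  linarith

/-- **The recursion bound `|Cₖⱼ| ≤ 2ᵏ·∏_{l≤k} C_ll`** for all `j`. [folklore] -/
theorem abs_C_le_two_pow_mul_prefix (htri : ∀ k j : Fin S.n, k < j → F.U k j = 0)
    (hbox : ∀ k j : Fin S.n, 0 ≤ F.U k j ∧ F.U k j ≤ (F.N : ℤ)) (k j : Fin S.n) :
    |F.C k j| ≤ 2 ^ (k : ℕ) * ∏ l ∈ Iic k, F.C l l := by
  classical
  obtain ⟨hCtri, hUCd, hCpos⟩ := F.shape htri hbox
  have hUpos := F.diag_pos htri hbox
  -- prefix products in `ℕ`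
  have he : ∀ l, ((F.C l l).toNat : ℤ) = F.C l l := fun l => Int.toNat_of_nonneg (hCpos l).le
  have he1 : ∀ l, 1 ≤ (F.C l l).toNat := fun l => by have := hCpos l; omega
  set T : Fin S.n → ℕ := fun k => ∏ l ∈ Iic k, (F.C l l).toNat with hT
  have hTcast : ∀ k, (T k : ℤ) = ∏ l ∈ Iic k, F.C l l := fun k => by
    rw [hT]; push_cast; exact Finset.prod_congr rfl fun l _ => he l
  have hTstep : ∀ i k : Fin S.n, i < k → T i * (F.C k k).toNat ≤ T k := by
    intro i k hik
    have hk : k ∉ Iic i := by rw [Finset.mem_Iic, not_le]; exact hik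
    have hsub : insert k (Iic i) ⊆ Iic k := by
      intro l hl
      rw [Finset.mem_insert, Finset.mem_Iic] at hl
      rw [Finset.mem_Iic]
      rcases hl with rfl | hl
      · exact le_rfl
      · exact hl.trans hik.le
    calc T i * (F.C k k).toNat = ∏ l ∈ insert k (Iic i), (F.C l l).toNat := by rw [Finset.prod_insert hk, mul_comm]
      _ ≤ T k := Finset.prod_le_prod_of_subset_of_one_le' hsub (fun l _ _ => he1 l)
  have hTk : ∀ k, (F.C k k).toNat ≤ T k := fun k =>
    Finset.single_le_prod' (fun l _ => he1 l) (Finset.mem_Iic.mpr le_rfl)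
  -- induction on the row index
  suffices key : ∀ m : ℕ, ∀ k : Fin S.n, (k : ℕ) = m → ∀ j, |F.C k j| ≤ 2 ^ m * (T k : ℤ) by
    have := key k k rfl j
    rwa [hTcast] at this
  intro m
  induction m using Nat.strong_induction_on with
  | _ m ih =>
    intro k hk j
    have hT0 : (0 : ℤ) < T k := by have := (he1 k).trans (hTk k); exact_mod_cast this
    rcases lt_trichotomy k j with hkj | hkj | hkj
    · rw [hCtri k j hkj, abs_zero]; positivity
    · subst hkj
      rw [abs_of_pos (hCpos k)]
      have h1 : F.C k k ≤ (T k : ℤ) := by rw [← he k]; exact_mod_cast hTk k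
      have h2 : (T k : ℤ) ≤ 2 ^ m * T k := le_mul_of_one_le_left hT0.le (one_le_pow₀ (by norm_num))
      linarith
    · -- `j < k`: the recurrence from row `k`, column `j` of `U·C = N·1`
      have hrow : ∑ i, F.U k i * F.C i j = 0 := by
        have h := congrFun (congrFun F.hUC k) j
        rw [Matrix.mul_apply] at h
        rw [h, Matrix.smul_apply, Matrix.one_apply, if_neg (ne_of_gt hkj), smul_zero]
      rw [← Finset.add_sum_erase _ _ (Finset.mem_univ k)] at hrow
      have hterm : ∀ i ∈ Finset.univ.erase k, |F.U k i * F.C i j| ≤ if i < k then (F.N : ℤ) * (2 ^ (i : ℕ) * (T i : ℤ)) else 0 := by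
        intro i hi
        have hik : i ≠ k := Finset.ne_of_mem_erase hi
        rcases lt_or_gt_of_ne hik with h | h
        · rw [if_pos h, abs_mul, abs_of_nonneg (hbox k i).1]
          exact mul_le_mul (hbox k i).2 (ih i (by omega) i rfl j) (abs_nonneg _) (by positivity)
        · rw [if_neg (not_lt.mpr h.le), htri k i h, zero_mul, abs_zero]
      have hS : |F.U k k * F.C k j| ≤ (F.N : ℤ) * ∑ i ∈ Iio k, 2 ^ (i : ℕ) * (T i : ℤ) := by
        have h1 : F.U k k * F.C k j = -∑ i ∈ Finset.univ.erase k, F.U k i * F.C i j := by linarith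
        rw [h1, abs_neg]
        refine (Finset.abs_sum_le_sum_abs _ _).trans ((Finset.sum_le_sum hterm).trans ?_)
        rw [Finset.sum_ite, Finset.sum_const_zero, add_zero, ← Finset.mul_sum]
        refine le_of_eq ?_
        congr 1
        refine Finset.sum_congr ?_ (fun _ _ => rfl)
        ext i
        simp only [Finset.mem_filter, Finset.mem_erase, Finset.mem_univ, and_true, Finset.mem_Iio, ne_eq]
        exact ⟨fun h => h.2, fun h => ⟨ne_of_lt h, h⟩⟩
      -- `eₖ·Tᵢ ≤ Tₖ` and `Σ_{i<k} 2^i ≤ 2^k − 1`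
      have hS2 : ∑ i ∈ Iio k, 2 ^ (i : ℕ) * (T i : ℤ) * (F.C k k) ≤ (2 ^ (k : ℕ) - 1) * (T k : ℤ) := by
        calc ∑ i ∈ Iio k, 2 ^ (i : ℕ) * (T i : ℤ) * (F.C k k) ≤ ∑ i ∈ Iio k, 2 ^ (i : ℕ) * (T k : ℤ) := by
              refine Finset.sum_le_sum fun i hi => ?_
              rw [Finset.mem_Iio] at hi
              have h1 : (T i : ℤ) * F.C k k ≤ T k := by
                rw [← he k]; exact_mod_cast hTstep i k hi
              have h2 : (0 : ℤ) ≤ 2 ^ (i : ℕ) := by positivity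
              nlinarith
          _ = (∑ i ∈ Iio k, (2 : ℤ) ^ (i : ℕ)) * (T k : ℤ) := by rw [Finset.sum_mul]
          _ ≤ (2 ^ (k : ℕ) - 1) * (T k : ℤ) := mul_le_mul_of_nonneg_right (sum_two_pow_Iio_le k) hT0.le
      -- combine: `N·|Cₖⱼ| = Uₖₖ·eₖ·|Cₖⱼ| ≤ eₖ·N·Σ ≤ N·(2ᵏ − 1)·Tₖ`
      have hN : (0 : ℤ) < F.N := by exact_mod_cast F.hN
      have hUkk := hUpos k
      have hek := hCpos k
      have hmain : (F.N : ℤ) * |F.C k j| ≤ (F.N : ℤ) * ((2 ^ (k : ℕ) - 1) * (T k : ℤ)) := by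
        have h1 : (F.N : ℤ) * |F.C k j| = F.C k k * |F.U k k * F.C k j| := by
          rw [abs_mul, abs_of_pos hUkk, ← hUCd k]; ring
        rw [h1]
        calc F.C k k * |F.U k k * F.C k j| ≤ F.C k k * ((F.N : ℤ) * ∑ i ∈ Iio k, 2 ^ (i : ℕ) * (T i : ℤ)) :=
              mul_le_mul_of_nonneg_left hS hek.le
          _ = (F.N : ℤ) * ∑ i ∈ Iio k, 2 ^ (i : ℕ) * (T i : ℤ) * F.C k k := by rw [← Finset.sum_mul]; ring
          _ ≤ (F.N : ℤ) * ((2 ^ (k : ℕ) - 1) * (T k : ℤ)) := mul_le_mul_of_nonneg_left hS2 hN.le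
      have h2 := le_of_mul_le_mul_left hmain hN
      rw [hk] at h2
      nlinarith

/-- **THE PATH BOUND `|Cⱼₖ| ≤ 2^{n−1}·N`** from the v5 shape letters (no pivot reduction). [cite: Cassels1997, Ch. I §2.2; shape only] -/
theorem abs_C_le_two_pow (htri : ∀ k j : Fin S.n, k < j → F.U k j = 0) (hbox : ∀ k j : Fin S.n, 0 ≤ F.U k j ∧ F.U k j ≤ (F.N : ℤ))
    (hdet : F.C.det.natAbs = F.N) (j k : Fin S.n) : |F.C j k| ≤ ((2 ^ (S.n - 1) : ℕ) : ℤ) * F.N := by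
  classical
  obtain ⟨-, -, hCpos⟩ := F.shape htri hbox
  have h := F.abs_C_le_two_pow_mul_prefix htri hbox j k
  have hprod : ∏ l, F.C l l = F.N := F.prod_C_diag htri hbox hdet
  -- `∏_{l ≤ j} C_ll ≤ N` via ℕ
  have he : ∀ l, ((F.C l l).toNat : ℤ) = F.C l l := fun l => Int.toNat_of_nonneg (hCpos l).le
  have he1 : ∀ l, 1 ≤ (F.C l l).toNat := fun l => by have := hCpos l; omega
  have hTN : ∏ l ∈ Iic j, F.C l l ≤ (F.N : ℤ) := by
    have h1 : ∏ l ∈ Iic j, (F.C l l).toNat ≤ ∏ l, (F.C l l).toNat :=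
      Finset.prod_le_prod_of_subset_of_one_le' (Finset.subset_univ _) (fun l _ _ => he1 l)
    have h2 : ((∏ l, (F.C l l).toNat : ℕ) : ℤ) = F.N := by push_cast; simp_rw [he]; exact hprod
    have h3 : ((∏ l ∈ Iic j, (F.C l l).toNat : ℕ) : ℤ) = ∏ l ∈ Iic j, F.C l l := by push_cast; exact Finset.prod_congr rfl fun l _ => he l
    rw [← h3, ← h2]; exact_mod_cast h1
  have hpow : (2 : ℤ) ^ (j : ℕ) ≤ 2 ^ (S.n - 1) := pow_le_pow_right₀ (by norm_num) (by have := j.isLt; omega)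
  have hT0 : (0 : ℤ) ≤ ∏ l ∈ Iic j, F.C l l := Finset.prod_nonneg fun l _ => (hCpos l).le
  push_cast
  calc |F.C j k| ≤ 2 ^ (j : ℕ) * ∏ l ∈ Iic j, F.C l l := h
    _ ≤ 2 ^ (S.n - 1) * (F.N : ℤ) := mul_le_mul hpow hTN hT0 (by positivity)

end SatData

end ArchG3Setup

end Summit.ABC.StewartYu

end
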